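import Literature.IUT.LogVolume.HolomorphicHull
import HarnessLib

/-!
# LANA §5.2 (d): the holomorphic hull as the smallest `VC(O)`-submodule containing `S`

LANA Project interim report (July 2026), §5.2 (d) p. 29, read on the page: "Note that `VC(K)` is
naturally a `VC(O)`-module. For a subset `S ⊂ VC(K)`, the holomorphic hull of `S`, denoted by `S^hol`,
is the smallest `VC(O)`-submodule of `VC(K)` that contains `S`." (with §5.2 (c): `VC(O)` = the direct
sum with every `K_w` replaced by `O_{K_w}`); [IUTchIII] Rmk. 3.9.5 (i) p. 127 defines the hull instead
as the smallest `λ·O` containing `S` (for `S` relatively compact) — the definition CONSTRUCTED in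
`HolomorphicHull.lean` of this directory; Dupuy–Hilado Rmk. 4.12.1: "The hull construction repairs this
by taking the smallest possible module containing this regions".

Over a finite direct sum `L = Π j, K j` of nonarchimedean local fields (norm presentation) with
`VC(O) = O_L = {a | ∀ j, ‖a_j‖ ≤ 1}` acting by multiplication, this file DEFINES LANA's hull
(`lanaHull K S` = the intersection of all `O_L`-submodules containing `S`, `IsIntegralSubmodule`) and
PROVES that the two hulls AGREE on bounded (= relatively compact) sets:
`lanaHull_eq_holomorphicHull : lanaHull K S = holomorphicHull K S` — in both the nondegenerate case
(attained radii, cf. `HullModel.exists_norm_apply_eq_hullRadius_of_exists`, re-proved privately here for one coordinate) and the degenerate one (a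
coordinate vanishing on `S` contributes `{0}` to both). For unbounded `S` the two conventions differ
by design ([IUTchIII] sets the hull to all of `I^ℚ(−)`), recorded in `lanaHull_subset_holomorphicHull`.
[cite: LANA2026Report, §5.2 (d) p. 29] [cite: Mochizuki2012, IUTchIII Rmk. 3.9.5 (i) p. 127]
[cite: DupuyHilado2025, Rmk. 4.12.1 p. 16]
Deliberately NOT here: the `I`-version `VC(I)` (log-shells; the `p`-adic logarithm files), the LGP element
(§5.2 (f)), any judgement on [IUTchIII] Cor. 3.12 or LANA's (9-1).
-/

noncomputable section

open Set Metric Bornology TopologicalSpace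
open scoped Pointwise NormedField

namespace Literature.IUT.LogVolume

variable {J : Type*} [Fintype J] (K : J → Type*) [∀ j, NontriviallyNormedField (K j)]

/-- `VC(O) = O_L = ∏_j O_{K_j}`: the elements of `⊕_j K_j` all of whose components are integral.
[cite: LANA2026Report, §5.2 (c) p. 29] -/
def integralElements : Set (Π j, K j) := {a | ∀ j, ‖a j‖ ≤ 1}

/-- A **`VC(O)`-submodule** of `VC(K) = ⊕_j K_j`: a subset containing `0`, closed under addition and under
multiplication by integral elements. [cite: LANA2026Report, §5.2 (d) p. 29] -/
@[mk_iff]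
structure IsIntegralSubmodule (M : Set (Π j, K j)) : Prop where
  /-- `0 ∈ M` -/
  zero_mem : (0 : Π j, K j) ∈ M
  /-- closed under addition -/
  add_mem : ∀ ⦃x y⦄, x ∈ M → y ∈ M → x + y ∈ M
  /-- stable under `VC(O)` -/
  mul_mem : ∀ ⦃a x⦄, a ∈ integralElements K → x ∈ M → a * x ∈ M

/-- **LANA's holomorphic hull** `S^hol`: the smallest `VC(O)`-submodule of `VC(K)` containing `S` (the
intersection of all of them; `VC(K)` itself is one). [cite: LANA2026Report, §5.2 (d) p. 29] -/
def lanaHull (S : Set (Π j, K j)) : Set (Π j, K j) := ⋂₀ {M | IsIntegralSubmodule K M ∧ S ⊆ M}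

omit [Fintype J] in
/-- `S ⊆ S^hol`. [cite: LANA2026Report, §5.2 (d) p. 29] -/
theorem subset_lanaHull (S : Set (Π j, K j)) : S ⊆ lanaHull K S :=
  subset_sInter fun _ hM => hM.2

omit [Fintype J] in
/-- `S^hol` lies in every `VC(O)`-submodule containing `S` (minimality).
[cite: LANA2026Report, §5.2 (d) p. 29] -/
theorem lanaHull_subset {S M : Set (Π j, K j)} (hM : IsIntegralSubmodule K M) (hSM : S ⊆ M) :
    lanaHull K S ⊆ M :=
  sInter_subset_of_mem ⟨hM, hSM⟩

omit [Fintype J] in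
/-- `S^hol` is itself a `VC(O)`-submodule (so it IS the smallest one containing `S`).
[cite: LANA2026Report, §5.2 (d) p. 29] -/
theorem isIntegralSubmodule_lanaHull (S : Set (Π j, K j)) : IsIntegralSubmodule K (lanaHull K S) where
  zero_mem := mem_sInter.mpr fun _ hM => hM.1.zero_mem
  add_mem _ _ hx hy := mem_sInter.mpr fun M hM => hM.1.add_mem (mem_sInter.mp hx M hM)
    (mem_sInter.mp hy M hM)
  mul_mem _ _ ha hx := mem_sInter.mpr fun M hM => hM.1.mul_mem ha (mem_sInter.mp hx M hM)

variable [∀ j, IsUltrametricDist (K j)]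

omit [Fintype J] in
/-- A polydisc `∏ closedBall 0 r_j` is a `VC(O)`-submodule (ultrametric: closed balls are subgroups;
`‖a_j x_j‖ ≤ ‖x_j‖` for integral `a`). [cite: LANA2026Report, §5.2 (d) p. 29] -/
theorem isIntegralSubmodule_polydisc (r : J → ℝ) (hr : ∀ j, 0 ≤ r j) :
    IsIntegralSubmodule K (polydisc K r) where
  zero_mem := (mem_polydisc K).mpr fun j => by simpa using hr j
  add_mem x y hx hy := (mem_polydisc K).mpr fun j => by
    rw [Pi.add_apply]
    exact (IsUltrametricDist.norm_add_le_max _ _).trans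
      (max_le ((mem_polydisc K).mp hx j) ((mem_polydisc K).mp hy j))
  mul_mem a x ha hx := (mem_polydisc K).mpr fun j => by
    rw [Pi.mul_apply, norm_mul]
    calc ‖a j‖ * ‖x j‖ ≤ 1 * ‖x j‖ := by gcongr; exact ha j
      _ = ‖x j‖ := one_mul _
      _ ≤ r j := (mem_polydisc K).mp hx j

variable [∀ j, ProperSpace (K j)]

/-- Coordinatewise attainment of the radius (one coordinate nonzero somewhere on `U`); same proof as
`HullModel.exists_norm_apply_eq_hullRadius_of_exists`. [cite: Mochizuki2012, IUTchIII Rmk. 3.9.5 (i) p. 127] -/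
private theorem exists_norm_eq_hullRadius_at {U : Set (Π j, K j)} (hU : IsBounded U) (j : J)
    (hj : ∃ u ∈ U, u j ≠ 0) : ∃ u ∈ U, ‖u j‖ = hullRadius K U j ∧ 0 < ‖u j‖ := by
  obtain ⟨u₀, hu₀, hu₀j⟩ := hj
  have hcont : ContinuousOn (fun u : Π j, K j => ‖u j‖) (closure U) :=
    ((continuous_apply j).norm).continuousOn
  obtain ⟨c, hc, hcmax⟩ := hU.isCompact_closure.exists_isMaxOn ⟨u₀, subset_closure hu₀⟩ hcont
  have hcpos : 0 < ‖c j‖ := lt_of_lt_of_le (norm_pos_iff.mpr hu₀j) (hcmax (subset_closure hu₀))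
  obtain ⟨t, ht, hdist⟩ := Metric.mem_closure_iff.mp hc ‖c j‖ hcpos
  have htj : ‖t j - c j‖ < ‖c j‖ := by
    calc ‖t j - c j‖ = ‖(t - c) j‖ := by simp
      _ ≤ ‖t - c‖ := norm_le_pi_norm _ j
      _ = dist t c := (dist_eq_norm t c).symm
      _ < ‖c j‖ := by rw [dist_comm]; exact hdist
  have hteq : ‖t j‖ = ‖c j‖ := by
    have := IsUltrametricDist.norm_add_eq_max_of_norm_ne_norm htj.ne
    rw [sub_add_cancel] at this
    rw [this, max_eq_right htj.le]
  refine ⟨t, ht, le_antisymm (norm_apply_le_hullRadius K hU ht j) ?_, hteq ▸ hcpos⟩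
  refine hullRadius_le K ⟨t, ht⟩ fun u hu => ?_
  rw [hteq]
  exact hcmax (subset_closure hu)

omit [Fintype J] [∀ j, ProperSpace (K j)] in
/-- The constructed hull of a bounded set is a `VC(O)`-submodule.
[cite: Mochizuki2012, IUTchIII Rmk. 3.9.5 (i) p. 127] -/
theorem isIntegralSubmodule_holomorphicHull {S : Set (Π j, K j)} (hS : IsBounded S) :
    IsIntegralSubmodule K (holomorphicHull K S) := by
  rw [holomorphicHull_of_isBounded K hS]
  exact isIntegralSubmodule_polydisc K _ (hullRadius_nonneg K S)

omit [∀ j, ProperSpace (K j)] in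
/-- Hence `S^hol ⊆` the constructed hull, for bounded `S`. [cite: LANA2026Report, §5.2 (d) p. 29] -/
theorem lanaHull_subset_holomorphicHull {S : Set (Π j, K j)} (hS : IsBounded S) :
    lanaHull K S ⊆ holomorphicHull K S :=
  lanaHull_subset K (isIntegralSubmodule_holomorphicHull K hS) (subset_holomorphicHull K S)

/-- The key step: a `VC(O)`-submodule `M ⊇ S` contains, for every `j` and every `x` in the constructed
hull of `S`, the vector `(0,…,x_j,…,0)` — via an element of `S` whose `j`-th coordinate attains the
radius (nondegenerate coordinate) or because `x_j = 0` (degenerate coordinate).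
[cite: LANA2026Report, §5.2 (d) p. 29] -/
theorem single_mem_of_isIntegralSubmodule [DecidableEq J] {S M : Set (Π j, K j)} (hS : IsBounded S)
    (hM : IsIntegralSubmodule K M) (hSM : S ⊆ M) {x : Π j, K j} (hx : x ∈ holomorphicHull K S)
    (j : J) : Pi.single j (x j) ∈ M := by
  rw [holomorphicHull_of_isBounded K hS, mem_polydisc] at hx
  by_cases hj : ∃ u ∈ S, u j ≠ 0
  · -- nondegenerate coordinate: scale an element of `S` with `‖u_j‖ = r_j` by `Pi.single j (x_j/u_j)`
    obtain ⟨u, hu, hnorm, hpos⟩ := exists_norm_eq_hullRadius_at K hS j hj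
    have huj : u j ≠ 0 := norm_pos_iff.mp hpos
    have ha : Pi.single j (x j / u j) ∈ integralElements K := fun i => by
      by_cases hij : i = j
      · subst hij
        rw [Pi.single_eq_same, norm_div, div_le_one hpos, hnorm]
        exact hx i
      · rw [Pi.single_eq_of_ne hij, norm_zero]; exact zero_le_one
    have hprod : Pi.single j (x j / u j) * u = Pi.single j (x j) := by
      funext i
      by_cases hij : i = j
      · subst hij; simp [div_mul_cancel₀ _ huj]
      · simp [Pi.single_eq_of_ne hij]
    rw [← hprod]
    exact hM.mul_mem ha (hSM hu)
  · -- degenerate coordinate: the radius is `0`, so `x_j = 0`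
    push Not at hj
    have hr : hullRadius K S j ≤ 0 :=
      hullRadius_le_of_nonneg K le_rfl fun u hu => by rw [hj u hu, norm_zero]
    have hxj : x j = 0 := norm_le_zero_iff.mp ((hx j).trans hr)
    rw [hxj, Pi.single_zero]
    exact hM.zero_mem

/-- **LANA's hull IS the constructed ([IUTchIII] Rmk. 3.9.5) hull on bounded sets**: the smallest
`VC(O)`-submodule containing a bounded `S ⊆ ⊕_j K_j` is the polydisc `∏ closedBall 0 (sup_{s∈S} ‖s_j‖)`
(= the smallest `λ·O_L ⊇ S` when `S` is nondegenerate). [cite: LANA2026Report, §5.2 (d) p. 29] -/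
theorem lanaHull_eq_holomorphicHull {S : Set (Π j, K j)} (hS : IsBounded S) :
    lanaHull K S = holomorphicHull K S := by
  classical
  refine le_antisymm (lanaHull_subset_holomorphicHull K hS) fun x hx => ?_
  refine mem_sInter.mpr fun M hM => ?_
  -- `x = Σ_j (0,…,x_j,…,0)`, each summand in `M`
  rw [← Finset.univ_sum_single x]
  refine Finset.sum_induction _ (· ∈ M) (fun a b ha hb => hM.1.add_mem ha hb) hM.1.zero_mem
    fun j _ => ?_
  exact single_mem_of_isIntegralSubmodule K hS hM.1 hM.2 hx j

/-- In particular, for bounded NONDEGENERATE `S`, LANA's hull is a hull set `λ·O_L` with every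
`λ_j ≠ 0` — the [IUTchIII] form. [cite: Mochizuki2012, IUTchIII Rmk. 3.9.5 (i) p. 127] -/
theorem isHullSet_lanaHull {S : Set (Π j, K j)} (hS : IsBounded S) (hnd : IsNondegenerate K S) :
    IsHullSet K (lanaHull K S) := by
  rw [lanaHull_eq_holomorphicHull K hS]
  exact isHullSet_holomorphicHull K hS hnd

end Literature.IUT.LogVolume
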